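import Mathlib

/-!
# The `R ≤ c` arithmetic of line `cgy-variance-pivot` fails beyond `c = 2.49` (negative lemma for crux stmt-SmoothPoincare4-10870)

The picked line `cgy-variance-pivot` for crux `EntropyRung.CompactShrinkerGap` reaches its transfer target,
the variance budget `D < 2V − 96π²` (`D = ∫(R−2)² dV`, `V = Vol`), in the landed sufficient condition
`Theorems.stub_varianceBudget_of_scalarCurvature_le` (p73066) from three real facts about a closed
normalised 4-d gradient shrinker with `R ≤ c` pointwise: the volume floor `32π²√π e^{1/2} < V`
(density + Jensen), `0 ≤ R` with `∫R dV = 2V`, whence `D ≤ 2V(c − 2)`, and the choice `c = 2.48`.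
This file records that `2.48` is essentially the CEILING of that arithmetic: already at `c = 2.49` the
two inequalities `32π²√π e^{1/2} < V` and `D ≤ 2V(c − 2)` no longer imply the budget (explicit witness
`V = 94π²` — admissible because `√π e^{1/2} < 1.7725·1.6488 < 94/32` — and `D = 2V·0.49 = 92.12π² ≥ 92π² =
2V − 96π²`). PAPER: the exact ceiling is `c* = 3 − 48π²/V₀ = 3 − 3/(2√π e^{1/2}) = 2.48672…`
(`V₀ = 32π²√π e^{1/2}`), so a pointwise scalar-curvature hypothesis weaker than `R ≤ 2.4867` needs more input
than `∫R = 2V` (e.g. the Cheng–Ribeiro–Zhou coarea bound, which reaches `R_max = f_max ≤ 3`,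
`varianceBudget_arith` / `crzArithmetic_false_at_exp_three_point_one`). Refuter negative lemma
(drefute gen 4), supports the crux item; pure real arithmetic.
-/

namespace Summit.SmoothPoincare4.SmoothPoincare4.Theorems.CompactShrinkerGap.Negative

-- the registered namespace repeats a component
set_option linter.dupNamespace false

/-- **The `R ≤ c` sub-case's arithmetic does not survive `c = 2.49`**: it is FALSE that for all reals
`V, D`, the volume floor `32π²√π e^{1/2} < V`, `0 ≤ D` and the traced bound `D ≤ 2V(2.49 − 2)` imply the
variance budget `D < 2V − 96π²`. Witness: `V = 94π²` (admissible since `32√π e^{1/2} < 32·1.7725·1.6488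
< 94`), `D = 2·94π²·0.49 = 92.12π² ≥ 92π² = 2V − 96π²`. Compare the landed
`stub_varianceBudget_of_scalarCurvature_le` (the same implication at `c = 2.48`). [folklore] -/
theorem scalarLeArithmetic_false_at_two_point_four_nine :
    ¬ (∀ V D : ℝ,
        32 * Real.pi ^ 2 * Real.sqrt Real.pi * Real.exp (1 / 2) < V →
        0 ≤ D →
        D ≤ 2 * V * ((2.49 : ℝ) - 2) →
        D < 2 * V - 96 * Real.pi ^ 2) := by
  intro h
  have hπ := Real.pi_pos
  have hp2 : 0 < Real.pi ^ 2 := by positivity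
  -- admissibility of `V = 94π²`: `32 √π e^{1/2} < 94`
  have hV : 32 * Real.pi ^ 2 * Real.sqrt Real.pi * Real.exp (1 / 2) < 94 * Real.pi ^ 2 := by
    have hs : Real.sqrt Real.pi < 1.7725 := by
      rw [Real.sqrt_lt' (by norm_num)]
      have := Real.pi_lt_d6; nlinarith
    have he : Real.exp (1 / 2) < 1.6488 := by
      have h2 : Real.exp (1 / 2) ^ 2 < (1.6488 : ℝ) ^ 2 := by
        rw [← Real.exp_nat_mul]; norm_num
        have := Real.exp_one_lt_d9; linarith
      exact lt_of_pow_lt_pow_left₀ 2 (by norm_num) h2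
    have hprod : Real.sqrt Real.pi * Real.exp (1 / 2) < 1.7725 * 1.6488 :=
      mul_lt_mul'' hs he (Real.sqrt_nonneg _) (Real.exp_pos _).le
    nlinarith [mul_pos hp2 (Real.exp_pos (1 / 2 : ℝ)), Real.sqrt_nonneg Real.pi]
  have hD0 : (0 : ℝ) ≤ 2 * (94 * Real.pi ^ 2) * ((2.49 : ℝ) - 2) := by positivity
  have hlt := h (94 * Real.pi ^ 2) (2 * (94 * Real.pi ^ 2) * ((2.49 : ℝ) - 2)) hV hD0 le_rfl
  -- but `2·94·0.49 = 92.12 ≥ 92 = 2·94 − 96`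
  nlinarith

/-- **The exact ceiling, sufficiency side** (so that the two lemmas bracket it): for every `c ≤ 2.486` the
same two inequalities DO imply the budget (`2V(c − 2) < 2V − 96π² ⟺ 96π² < 2V(3 − c)`, and
`2·32√π e^{1/2}·(3 − c) ≥ 64·2.9·0.514 > 96` needs only `2.9 < √π e^{1/2}`). [folklore] -/
theorem scalarLeArithmetic_holds_up_to_two_point_four_eight_six (c : ℝ) (hc : c ≤ 2.486) :
    ∀ V D : ℝ,
        32 * Real.pi ^ 2 * Real.sqrt Real.pi * Real.exp (1 / 2) < V →
        0 ≤ D →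
        D ≤ 2 * V * (c - 2) →
        D < 2 * V - 96 * Real.pi ^ 2 := by
  intro V D hV _hD hDle
  have hπ := Real.pi_pos
  have hp2 : 0 < Real.pi ^ 2 := by positivity
  have hs : (1.77245 : ℝ) < Real.sqrt Real.pi := by
    rw [Real.lt_sqrt (by norm_num)]
    have := Real.pi_gt_d6
    nlinarith
  have ht : (1.6487 : ℝ) < Real.exp (1 / 2) := by
    have h2 : (1.6487 : ℝ) ^ 2 < Real.exp (1 / 2) ^ 2 := by
      rw [← Real.exp_nat_mul]
      norm_num
      have := Real.exp_one_gt_d9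
      linarith
    exact lt_of_pow_lt_pow_left₀ 2 (Real.exp_pos _).le h2
  have h29 : (2.9222 : ℝ) < Real.sqrt Real.pi * Real.exp (1 / 2) := by
    calc (2.9222 : ℝ) < 1.77245 * 1.6487 := by norm_num
      _ < Real.sqrt Real.pi * Real.exp (1 / 2) := mul_lt_mul'' hs ht (by norm_num) (by norm_num)
  -- `V > 32π²·2.9222 = 93.51π²`, so `2V(3 − c) ≥ 2V·0.514 > 96π²`
  have hV' : 32 * Real.pi ^ 2 * 2.9222 < V := by
    calc 32 * Real.pi ^ 2 * 2.9222 < 32 * Real.pi ^ 2 * (Real.sqrt Real.pi * Real.exp (1 / 2)) :=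
          mul_lt_mul_of_pos_left h29 (by positivity)
      _ = 32 * Real.pi ^ 2 * Real.sqrt Real.pi * Real.exp (1 / 2) := by ring
      _ < V := hV
  have hVpos : 0 < V := by nlinarith
  nlinarith [mul_le_mul_of_nonneg_left hc (by positivity : (0 : ℝ) ≤ 2 * V)]

end Summit.SmoothPoincare4.SmoothPoincare4.Theorems.CompactShrinkerGap.Negative
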